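import Mathlib.CategoryTheory.IsomorphismClasses
import Literature.AnabelianGeometry.SemiGraphs.TemperoidsGCConnected

/-!
# [SemiAnbd] Proposition 3.2, "In particular": isomorphism classes of morphisms `T₁ → T₂` are the continuous outer homomorphisms `Π₁ → Π₂`

Mochizuki, *Semi-graphs of anabelioids*, Publ. RIMS **42** (2006), §3, Proposition 3.2, p. 35
[cite: MochizukiSemiAnbd2006, Prop 3.2 p.35], second sentence, verbatim: "In particular, there is a
natural bijective correspondence between the set of isomorphism classes of morphisms `T₁ → T₂` and
the set of [continuous] outer homomorphisms `Π₁ → Π₂`."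

The first sentence of Proposition 3.2 (the equivalence of the category of morphisms
`T₁ := B^temp(Π₁) → T₂ := B^temp(Π₂)` with the category `ContHomCat Π₁ Π₂` of continuous
homomorphisms-and-conjugating-elements) is the named fact `GCConnectedTemperoids` of
`Temperoids.lean`, discharged as `GCConnectedTemperoids_holds` (`TemperoidsGCConnected.lean`); the
second sentence was typed there only through its two halves `TemperoidHomEqRes` (every morphism is
`≅ B^temp(φ)`) and `ResIsoResIff` (`B^temp(φ) ≅ B^temp(ψ) ↔ ψ = γ_g ∘ φ`).  This PROOF-ONLY file
records the second sentence LITERALLY as kernel theorems, with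

* "the set of isomorphism classes of morphisms `T₁ → T₂`" =
  `Quotient (isIsomorphicSetoid (TemperoidHomCat (BTemp Π₁) (BTemp Π₂)))` (the tree's rendering of
  "isomorphism classes of objects of a category", as in the Frobenioid files), and
* "the set of continuous outer homomorphisms `Π₁ → Π₂`" =
  `Quotient (isIsomorphicSetoid (ContHomCat Π₁ Π₂))`, whose relation IS conjugacy
  (`ContHomCat.isIsomorphic_iff`: `φ ≅ ψ ↔ ∃ g, γ_g ∘ φ = ψ`):

1. `prop32_isoClasses_equiv` — the bijection, deduced exactly as printed ("In particular") from the
   equivalence of categories `GCConnectedTemperoids_holds` via the folklore fact that an equivalence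
   of categories induces a bijection of isomorphism classes (private helper
   `nonempty_isoClasses_equiv_of_equivalence`);
2. `prop32_isoClasses_natural_bijection` — the NATURAL correspondence pinned down: a bijection whose
   value on the outer class of `φ` is the isomorphism class of `B^temp(φ) = BTemp.res φ` (assembled
   from the landed halves `TemperoidHomEqRes_holds`, `ResIsoResIff_holds`, `ResIsTemperoidHom_holds`
   and `BTemp.resIsoOfConj`).

Galois-countability (second countability) of `Π₁, Π₂` is carried as in every Prop 3.2 named fact,
per the author's erratum [IUTchI] Rmk. 2.5.3 (ii) (E7).  No definition, no instance, no new named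
fact; the typer's statement file `Temperoids.lean` is imported unchanged.  (abc-iut cell, node
SemiAnbd:Prop3.2, print-coverage companion; typed ≠ endorsed.)
-/

namespace Literature.AnabelianGeometry.SemiGraphs

open CategoryTheory Topology

universe v₁ v₂ u₁ u₂ u

/-! ### Isomorphism classes of an equivalence of categories (folklore) -/

section IsoClasses

variable {C : Type u₁} [Category.{v₁} C] {D : Type u₂} [Category.{v₂} D]

/-- An equivalence of categories `e : C ≌ D` induces a bijection between the set of isomorphism
classes of objects of `C` and that of `D` (class of `X` ↦ class of `e.functor X`, inverse induced by
`e.inverse`, the unit and counit isomorphisms witnessing that these are mutually inverse).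
(Private helper.) [folklore] -/
private theorem nonempty_isoClasses_equiv_of_equivalence (e : C ≌ D) :
    Nonempty (Quotient (isIsomorphicSetoid C) ≃ Quotient (isIsomorphicSetoid D)) :=
  ⟨{ toFun := Quot.map e.functor.obj fun _ _ ⟨f⟩ => ⟨e.functor.mapIso f⟩
     invFun := Quot.map e.inverse.obj fun _ _ ⟨f⟩ => ⟨e.inverse.mapIso f⟩
     left_inv := by
       rintro ⟨X⟩
       exact Quot.sound ⟨(e.unitIso.app X).symm⟩
     right_inv := by
       rintro ⟨Y⟩
       exact Quot.sound ⟨e.counitIso.app Y⟩ }⟩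

end IsoClasses

/-! ### Isomorphism classes in `ContHomCat Π₁ Π₂` = continuous outer homomorphisms -/

section ContHom

variable {G₁ : Type u} [Group G₁] [TopologicalSpace G₁] {G₂ : Type u} [Group G₂]
  [TopologicalSpace G₂]

/-- In the category `ContHomCat Π₁ Π₂` of Proposition 3.2 (objects: continuous homomorphisms
`φ : Π₁ → Π₂`; morphisms `φ → ψ`: elements `g ∈ Π₂` with `γ_g ∘ φ = ψ`), two objects are isomorphic
if and only if they are conjugate, `ψ = γ_g ∘ φ` for some `g ∈ Π₂` — i.e. the isomorphism classes
of `ContHomCat Π₁ Π₂` are precisely the [continuous] outer homomorphisms `Π₁ → Π₂`.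
[cite: MochizukiSemiAnbd2006, Prop 3.2 p.35] -/
theorem ContHomCat.isIsomorphic_iff (φ ψ : ContHomCat G₁ G₂) :
    IsIsomorphic φ ψ ↔ ∃ g : G₂, ∀ x : G₁, g * φ.hom x * g⁻¹ = ψ.hom x := by
  constructor
  · rintro ⟨e⟩
    exact ⟨e.hom.elt, e.hom.conj_eq⟩
  · rintro ⟨g, hg⟩
    refine ⟨{ hom := ⟨g, hg⟩
              inv := ⟨g⁻¹, fun x => ?_⟩
              hom_inv_id := ?_
              inv_hom_id := ?_ }⟩
    · rw [← hg x, inv_inv, ← mul_assoc, ← mul_assoc, inv_mul_cancel, one_mul,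
        mul_assoc, inv_mul_cancel, mul_one]
    · exact ContHomCat.Hom.ext (show g⁻¹ * g = 1 from inv_mul_cancel g)
    · exact ContHomCat.Hom.ext (show g * g⁻¹ = 1 from mul_inv_cancel g)

end ContHom

/-! ### Proposition 3.2, second sentence -/

section Prop32

variable (G₁ : Type u) [Group G₁] [TopologicalSpace G₁] [IsTopologicalGroup G₁]
  [SecondCountableTopology G₁] (G₂ : Type u) [Group G₂] [TopologicalSpace G₂]
  [IsTopologicalGroup G₂] [SecondCountableTopology G₂]

/-- **[SemiAnbd] Proposition 3.2, second sentence** (p. 35): "In particular, there is a natural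
bijective correspondence between the set of isomorphism classes of morphisms `T₁ → T₂` and the set
of [continuous] outer homomorphisms `Π₁ → Π₂`" — here, exactly as printed, as the consequence of the
equivalence of categories of the first sentence (`GCConnectedTemperoids_holds`): for Galois-countable
tempered groups `Π₁, Π₂` the isomorphism classes of `TemperoidHomCat (B^temp Π₁) (B^temp Π₂)` are in
bijection with the isomorphism classes of `ContHomCat Π₁ Π₂`, which are the continuous outer
homomorphisms (`ContHomCat.isIsomorphic_iff`). [cite: MochizukiSemiAnbd2006, Prop 3.2 p.35] -/
theorem prop32_isoClasses_equiv (hG₁ : IsTempered G₁) (hG₂ : IsTempered G₂) :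
    Nonempty (Quotient (isIsomorphicSetoid (TemperoidHomCat (BTemp G₁) (BTemp G₂))) ≃
      Quotient (isIsomorphicSetoid (ContHomCat G₁ G₂))) := by
  obtain ⟨e⟩ := GCConnectedTemperoids_holds G₁ G₂ hG₁ hG₂
  exact nonempty_isoClasses_equiv_of_equivalence e

/-- **[SemiAnbd] Proposition 3.2, second sentence, with the naturality pinned down** (p. 35): for
Galois-countable tempered groups `Π₁, Π₂` there is a bijection from the set of continuous outer
homomorphisms `Π₁ → Π₂` (isomorphism classes of `ContHomCat Π₁ Π₂`, i.e. conjugacy classes of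
continuous homomorphisms, `ContHomCat.isIsomorphic_iff`) onto the set of isomorphism classes of
morphisms of temperoids `B^temp(Π₁) → B^temp(Π₂)` which IS the natural correspondence: it sends the
outer class of `φ` to the isomorphism class of `B^temp(φ)` (`BTemp.res φ`, a morphism of temperoids
by `ResIsTemperoidHom_holds`).  Well-definedness: `BTemp.resIsoOfConj`; injectivity: the landed half
`ResIsoResIff_holds`; surjectivity: the landed half `TemperoidHomEqRes_holds`.
[cite: MochizukiSemiAnbd2006, Prop 3.2 p.35] -/
theorem prop32_isoClasses_natural_bijection (hG₁ : IsTempered G₁) (hG₂ : IsTempered G₂) :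
    ∃ β : Quotient (isIsomorphicSetoid (ContHomCat G₁ G₂)) ≃
        Quotient (isIsomorphicSetoid (TemperoidHomCat (BTemp G₁) (BTemp G₂))),
      ∀ φ : G₁ →ₜ* G₂, β (Quotient.mk _ ⟨φ⟩) =
        Quotient.mk _ ⟨BTemp.res φ, ResIsTemperoidHom_holds G₁ G₂ hG₁ hG₂ φ⟩ := by
  classical
  -- `φ ↦ B^temp(φ)` on objects
  let r : ContHomCat G₁ G₂ → TemperoidHomCat (BTemp G₁) (BTemp G₂) := fun φ =>
    ⟨BTemp.res φ.hom, ResIsTemperoidHom_holds G₁ G₂ hG₁ hG₂ φ.hom⟩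
  -- it respects isomorphism: conjugate homomorphisms have isomorphic pull-back functors
  have hr : ∀ φ ψ : ContHomCat G₁ G₂, IsIsomorphic φ ψ → IsIsomorphic (r φ) (r ψ) := by
    intro φ ψ h
    obtain ⟨g, hg⟩ := (ContHomCat.isIsomorphic_iff φ ψ).1 h
    exact ⟨ObjectProperty.isoMk _ (BTemp.resIsoOfConj φ.hom ψ.hom g hg)⟩
  let b : Quotient (isIsomorphicSetoid (ContHomCat G₁ G₂)) →
      Quotient (isIsomorphicSetoid (TemperoidHomCat (BTemp G₁) (BTemp G₂))) := Quot.map r hr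
  -- injective: the injectivity half `ResIsoResIff`
  have hinj : Function.Injective b := by
    rintro ⟨φ⟩ ⟨ψ⟩ h
    obtain ⟨e⟩ : IsIsomorphic (r φ) (r ψ) := Quotient.exact h
    have e' : BTemp.res φ.hom ≅ BTemp.res ψ.hom := (ObjectProperty.ι _).mapIso e
    obtain ⟨g, hg⟩ := (ResIsoResIff_holds G₁ G₂ hG₁ hG₂ φ.hom ψ.hom).1 ⟨e'⟩
    exact Quot.sound ((ContHomCat.isIsomorphic_iff φ ψ).2 ⟨g, hg⟩)
  -- surjective: the surjectivity half `TemperoidHomEqRes`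
  have hsurj : Function.Surjective b := by
    rintro ⟨Φ⟩
    obtain ⟨φ, ⟨e⟩⟩ :=
      TemperoidHomEqRes_holds G₁ G₂ hG₁ hG₂ ⟨Φ.obj, Φ.property.1, Φ.property.2⟩
    have i : Φ ≅ r ⟨φ⟩ := ObjectProperty.isoMk _ e
    exact ⟨Quotient.mk _ ⟨φ⟩, Quot.sound ⟨i.symm⟩⟩
  exact ⟨Equiv.ofBijective b ⟨hinj, hsurj⟩, fun φ => rfl⟩

end Prop32

end Literature.AnabelianGeometry.SemiGraphs
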